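import Literature.Barriers.QuantumAdvantage.LatticeRigidity
import Mathlib.LinearAlgebra.Matrix.Notation
import Mathlib.NumberTheory.Padics.Hensel
import Mathlib.Tactic.FinCases
import HarnessLib

/-!
# Lattice rigidity of the Toffoli+Hadamard gate group — proved witnesses

Companion to `Literature/Barriers/QuantumAdvantage/LatticeRigidity.lean` (barrier
`latticeRigidity_finiteImage`, D-0021). Everything here is PROVED; no named facts.

* `LatticeRigidity.infinite_dyadicOrthogonalGroup` — `Γ_N = O_N(ℤ[1/2])` is infinite for `N ≥ 5`:
  the product `M = s_w s_{w'}` of the dyadic reflections in `w = (1,1,1,1,0)`, `w' = (0,1,1,1,1)`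
  has infinite order since `(Mᵏ w)₀ = u_k / 4ᵏ` with `u_k` odd (`u_{k+2} = u_{k+1} - 16 u_k`); it
  is padded block-diagonally into `Γ_{5+M}`. Hence `infinite_toffoliHadamardGroup` (`n ≥ 3`) and
  the unconditional reading `latticeRigidity_finiteImage.not_injective` (no compressed linear
  shadow of `Γ_{2ⁿ}`, `n ≥ 3`, is faithful).
* `LatticeRigidity.finite_dyadicOrthogonalGroup_four` — `Γ_4` is FINITE (two rebits are a toy):
  a dyadic column of norm `1` has entries in `{0, ±½, ±1}` (`a² + b² + c² + d² ≡ 0 (mod 8)` forces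
  `a, b, c, d` even — `decide` in `ℤ/8` — plus descent on the denominator); the integral shadow
  of the anisotropy of `⟨1,1,1,1⟩` over `ℚ₂` [cite: Omeara1963, 63:17 and 63:18].
* `LatticeRigidity.exists_antiIsometry_two_adic` — the rank input of the barrier, certified:
  `-7` is a square in `ℤ₂` (Hensel), so `T = L(u + i + j + 2k)` has `Tᵀ T = (u²+6)·1 = -1` and the
  graph `{(v, Tv)}` is a totally isotropic rank-`4` summand of `(ℤ₂⁸, Σ xᵢ²)`: `8·⟨1⟩` is
  hyperbolic over `ℚ₂`, `rank_{ℚ₂} SO₈ = 4 ≥ 2` (cf. [cite: Omeara1963, 63:19]).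

References: [Omeara1963] O'Meara, *Introduction to Quadratic Forms* (1963), 63:17–63:19;
[Margulis1991] Margulis, *Discrete Subgroups of Semisimple Lie Groups* (1991), Ch. VIII (B), (C).
-/

noncomputable section

open Matrix

namespace Literature.Barriers.QuantumAdvantage

namespace LatticeRigidity

/-! ### An element of infinite order in `Γ_5 = O_5(ℤ[1/2])` -/

/-- Numerators of `4 · M`, where `M = s_w s_{w'}` is the product of the reflections of `ℚ⁵` in
`w = (1,1,1,1,0)` and `w' = (0,1,1,1,1)` (both reflections have matrix `1 - ½ w wᵀ`, dyadic).
[folklore] -/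
def rotGenInt : Matrix (Fin 5) (Fin 5) ℤ :=
  !![2, 1, 1, 1, 3; -2, 3, -1, -1, 1; -2, -1, 3, -1, 1; -2, -1, -1, 3, 1; 0, -2, -2, -2, 2]

/-- `M = s_w s_{w'} ∈ O_5(ℚ)`: a rotation by the angle `φ`, `cos φ = 1/8`, in the plane `⟨w, w'⟩`,
with entries in `¼ℤ`. [folklore] -/
def rotGen : Matrix (Fin 5) (Fin 5) ℚ :=
  Matrix.of fun i j => (rotGenInt i j : ℚ) / 4

/-- `M Mᵀ = 1`. [folklore] -/
theorem rotGen_mul_transpose : rotGen * rotGenᵀ = 1 := by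
  ext i j
  fin_cases i <;> fin_cases j <;>
    simp [rotGen, rotGenInt, Matrix.mul_apply, Fin.sum_univ_five] <;> norm_num

/-- The entries of `M` are dyadic. [folklore] -/
theorem rotGen_dyadic (i j : Fin 5) : rotGen i j ∈ dyadicRationals :=
  ⟨rotGenInt i j, 2, by simp only [rotGen, Matrix.of_apply]; norm_num⟩

/-- `M` as an element `γ ∈ Γ_5`. [folklore] -/
def rotGenElem : dyadicOrthogonalGroup 5 :=
  dyadicOrthogonalGroup.mkOfMatrix rotGen rotGen_mul_transpose rotGen_dyadic

/-- The vector `w = (1,1,1,1,0)`. [folklore] -/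
def wInt : Fin 5 → ℤ := ![1, 1, 1, 1, 0]

/-- `(4M)² w = (4M) w - 16 w`, i.e. `M² w = ¼ M w - w` (on the plane `⟨w, w'⟩` the rotation `M`
satisfies `X² - ¼X + 1 = 0`). [folklore] -/
theorem rotGenInt_recurrence :
    rotGenInt *ᵥ (rotGenInt *ᵥ wInt) = rotGenInt *ᵥ wInt - (16 : ℤ) • wInt := by
  decide

/-- The integer sequence `u_k = ((4M)ᵏ w)₀ = 4ᵏ (Mᵏ w)₀`: `1, 5, -11, -91, 85, …`. [folklore] -/
def uSeq (k : ℕ) : ℤ := (rotGenInt ^ k *ᵥ wInt) 0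

/-- `u_{k+2} = u_{k+1} - 16 u_k`. [folklore] -/
theorem uSeq_rec (k : ℕ) : uSeq (k + 2) = uSeq (k + 1) - 16 * uSeq k := by
  have h : rotGenInt ^ (k + 2) *ᵥ wInt =
      rotGenInt ^ (k + 1) *ᵥ wInt - (16 : ℤ) • (rotGenInt ^ k *ᵥ wInt) := by
    rw [pow_add, ← mulVec_mulVec, pow_two, ← mulVec_mulVec, rotGenInt_recurrence, mulVec_sub,
      mulVec_smul, mulVec_mulVec, ← pow_succ]
  simp only [uSeq, h, Pi.sub_apply, Pi.smul_apply, smul_eq_mul]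

/-- Every `u_k` is odd (so `(Mᵏ w)₀ = u_k / 4ᵏ` has `2`-adic valuation exactly `-2k`). [folklore] -/
theorem uSeq_odd : ∀ k : ℕ, Odd (uSeq k)
  | 0 => by decide
  | 1 => by decide
  | k + 2 => by
    rw [uSeq_rec]
    exact (uSeq_odd (k + 1)).sub_even ((by decide : Even (16 : ℤ)).mul_right _)

/-- `Mᵏ w = (4M)ᵏ w / 4ᵏ` (with `w` viewed as a rational vector). [folklore] -/
theorem rotGen_pow_mulVec (k : ℕ) :
    rotGen ^ k *ᵥ (fun i => (wInt i : ℚ)) = fun i => ((rotGenInt ^ k *ᵥ wInt) i : ℚ) / 4 ^ k := by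
  induction k with
  | zero => ext i; simp
  | succ k ih =>
    rw [pow_succ', ← mulVec_mulVec, ih, pow_succ', ← mulVec_mulVec]
    ext i
    simp only [Matrix.mulVec, dotProduct, rotGen, Matrix.of_apply, Fin.sum_univ_five]
    push_cast
    ring

/-- `M` has infinite order: `k ↦ Mᵏ` is injective (the values `u_k / 4ᵏ`, `u_k` odd, are pairwise
distinct). [folklore] -/
theorem rotGen_pow_injective : Function.Injective fun k : ℕ => rotGen ^ k := by
  intro j k hjk
  simp only at hjk
  wlog hle : j ≤ k generalizing j k
  · exact (this hjk.symm (le_of_not_ge hle)).symm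
  rcases hle.eq_or_lt with rfl | hlt
  · rfl
  exfalso
  obtain ⟨e, rfl⟩ := Nat.exists_eq_add_of_lt hlt
  have hq : (uSeq j : ℚ) / 4 ^ j = (uSeq (j + e + 1) : ℚ) / 4 ^ (j + e + 1) := by
    have h0 := congrFun (rotGen_pow_mulVec j) 0
    rw [hjk, congrFun (rotGen_pow_mulVec (j + e + 1)) 0] at h0
    exact h0.symm
  have h4 : (4 : ℚ) ^ j ≠ 0 := pow_ne_zero _ (by norm_num)
  have hq' : (uSeq (j + e + 1) : ℚ) = uSeq j * 4 ^ (e + 1) := by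
    rw [div_eq_div_iff h4 (pow_ne_zero _ (by norm_num))] at hq
    apply mul_right_cancel₀ h4
    rw [show (4 : ℚ) ^ (j + e + 1) = 4 ^ (e + 1) * 4 ^ j by ring] at hq
    linear_combination -hq
  have hint : uSeq (j + e + 1) = uSeq j * 4 ^ (e + 1) := by exact_mod_cast hq'
  have heven : Even (uSeq j * 4 ^ (e + 1)) :=
    Even.mul_left (by rw [pow_succ]; exact Even.mul_left (by decide) _) _
  exact (Int.not_even_iff_odd.mpr (uSeq_odd _)) (hint ▸ heven)

/-- `Γ_5 = O_5(ℤ[1/2])` is infinite (it contains the infinite-order rotation `M = s_w s_{w'}`).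
[folklore] -/
theorem infinite_dyadicOrthogonalGroup_five : Infinite (dyadicOrthogonalGroup 5) := by
  refine Infinite.of_injective (fun k : ℕ => rotGenElem ^ k) fun j k hjk => ?_
  apply rotGen_pow_injective
  have h := congrArg
    (fun g : dyadicOrthogonalGroup 5 => ((g : Matrix.orthogonalGroup (Fin 5) ℚ) : Matrix (Fin 5) (Fin 5) ℚ)) hjk
  simpa [rotGenElem] using h

/-! ### Block-diagonal padding `Γ_N ↪ Γ_{N+M}` and infinitude of `Γ_{2ⁿ}`, `n ≥ 3` -/

/-- `A ↦ A ⊕ 1_M`, reindexed to `Fin (N + M)`. [folklore] -/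
def padMatrix {N : ℕ} (A : Matrix (Fin N) (Fin N) ℚ) (M : ℕ) : Matrix (Fin (N + M)) (Fin (N + M)) ℚ :=
  Matrix.reindex finSumFinEquiv finSumFinEquiv (Matrix.fromBlocks A 0 0 (1 : Matrix (Fin M) (Fin M) ℚ))

/-- Padding preserves orthogonality. [folklore] -/
theorem padMatrix_mul_transpose {N : ℕ} {A : Matrix (Fin N) (Fin N) ℚ} (hA : A * Aᵀ = 1) (M : ℕ) :
    padMatrix A M * (padMatrix A M)ᵀ = 1 := by
  simp only [padMatrix, Matrix.reindex_apply, Matrix.transpose_submatrix, Matrix.fromBlocks_transpose,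
    Matrix.submatrix_mul_equiv, Matrix.fromBlocks_multiply, Matrix.transpose_zero, Matrix.transpose_one,
    Matrix.mul_zero, Matrix.zero_mul, add_zero, zero_add, Matrix.mul_one, hA, Matrix.fromBlocks_one,
    Matrix.submatrix_one_equiv]

/-- Padding preserves dyadic entries. [folklore] -/
theorem padMatrix_dyadic {N : ℕ} {A : Matrix (Fin N) (Fin N) ℚ} (hA : ∀ i j, A i j ∈ dyadicRationals)
    (M : ℕ) (i j : Fin (N + M)) : padMatrix A M i j ∈ dyadicRationals := by
  simp only [padMatrix, Matrix.reindex_apply, Matrix.submatrix_apply]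
  rcases finSumFinEquiv.symm i with a | a <;> rcases finSumFinEquiv.symm j with b | b
  · simpa using hA a b
  · simp
  · simp
  · simp only [Matrix.fromBlocks_apply₂₂, Matrix.one_apply]
    split_ifs
    · exact Subring.one_mem _
    · exact Subring.zero_mem _

/-- Padding is injective. [folklore] -/
theorem padMatrix_injective {N : ℕ} (M : ℕ) : Function.Injective fun A : Matrix (Fin N) (Fin N) ℚ => padMatrix A M := by
  intro A B h
  have h' := (Matrix.reindex finSumFinEquiv finSumFinEquiv).injective h
  simpa using congrArg Matrix.toBlocks₁₁ h'

/-- The block-diagonal embedding `Γ_N ↪ Γ_{N+M}`, `g ↦ g ⊕ 1`. [folklore] -/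
def pad {N : ℕ} (M : ℕ) (g : dyadicOrthogonalGroup N) : dyadicOrthogonalGroup (N + M) :=
  dyadicOrthogonalGroup.mkOfMatrix
    (padMatrix ((g : Matrix.orthogonalGroup (Fin N) ℚ) : Matrix (Fin N) (Fin N) ℚ) M)
    (padMatrix_mul_transpose ((Matrix.mem_orthogonalGroup_iff (Fin N) ℚ).1 g.1.2) M)
    (padMatrix_dyadic g.2 M)

/-- `pad` is injective. [folklore] -/
theorem pad_injective {N : ℕ} (M : ℕ) : Function.Injective (pad (N := N) M) := by
  intro g h hgh
  have h1 := congrArg (fun x : dyadicOrthogonalGroup (N + M) =>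
    ((x : Matrix.orthogonalGroup (Fin (N + M)) ℚ) : Matrix (Fin (N + M)) (Fin (N + M)) ℚ)) hgh
  simp only [pad, dyadicOrthogonalGroup.coe_mkOfMatrix] at h1
  exact Subtype.ext (Subtype.ext (padMatrix_injective M h1))

/-- `Γ_N = O_N(ℤ[1/2])` is infinite for every `N ≥ 5`. [folklore] -/
theorem infinite_dyadicOrthogonalGroup {N : ℕ} (hN : 5 ≤ N) : Infinite (dyadicOrthogonalGroup N) := by
  obtain ⟨M, rfl⟩ := Nat.exists_eq_add_of_le hN
  haveI := infinite_dyadicOrthogonalGroup_five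
  exact Infinite.of_injective (pad M) (pad_injective M)

/-- The `n`-qubit Toffoli+Hadamard gate group `Γ_{2ⁿ}` is infinite for `n ≥ 3`. [folklore] -/
theorem infinite_toffoliHadamardGroup {n : ℕ} (hn : 3 ≤ n) : Infinite (toffoliHadamardGroup n) :=
  infinite_dyadicOrthogonalGroup
    (le_trans (by norm_num) (Nat.pow_le_pow_right (by norm_num) hn) : 5 ≤ 2 ^ n)

end LatticeRigidity

/-- READING 4, unconditional form: for `n ≥ 3` and `d < 2ⁿ`, NO linear shadow
`ρ : Γ_{2ⁿ} →* GL_d(ℂ)` is faithful (finite image of an infinite group).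
[cite: Margulis1991, Ch. VIII Theorems (B) and (C)] -/
theorem latticeRigidity_finiteImage.not_injective (h : latticeRigidity_finiteImage) {n d : ℕ}
    (hn : 3 ≤ n) (hd : d < 2 ^ n) (ρ : LinearShadow n d) : ¬ Function.Injective ρ :=
  haveI := LatticeRigidity.infinite_toffoliHadamardGroup hn
  h.not_injective_of_infinite hn hd ρ

namespace LatticeRigidity

/-! ### Two rebits are a toy: `Γ_4 = O_4(ℤ[1/2])` is finite -/

/-- Sums of four squares modulo `8`: `a² + b² + c² + d² = 0` in `ℤ/8` forces `4a = 0` (i.e. `a`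
even). [folklore] -/
theorem four_mul_eq_zero_of_sum_sq (a b c d : ZMod 8) (h : a ^ 2 + b ^ 2 + c ^ 2 + d ^ 2 = 0) :
    4 * a = 0 := by
  revert a b c d h
  decide

/-- If `8 ∣ a² + b² + c² + d²` then `a` is even. [folklore] -/
theorem two_dvd_of_eight_dvd_sum_sq {a b c d : ℤ} (h : (8 : ℤ) ∣ a ^ 2 + b ^ 2 + c ^ 2 + d ^ 2) :
    (2 : ℤ) ∣ a := by
  have h8 : ((a ^ 2 + b ^ 2 + c ^ 2 + d ^ 2 : ℤ) : ZMod 8) = 0 :=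
    (ZMod.intCast_zmod_eq_zero_iff_dvd _ 8).2 h
  push_cast at h8
  have h4 := four_mul_eq_zero_of_sum_sq _ _ _ _ h8
  have h4' : ((4 * a : ℤ) : ZMod 8) = 0 := by push_cast; exact h4
  have := (ZMod.intCast_zmod_eq_zero_iff_dvd _ 8).1 h4'
  omega

/-- Descent: an integer vector `v ∈ ℤ⁴` with `∑ vᵢ² = 4ᵏ` has `vᵢ / 2ᵏ ∈ {0, ±½, ±1}`. [folklore] -/
theorem half_integer_of_sum_sq_eq (k : ℕ) (v : Fin 4 → ℤ) (hv : ∑ i, v i ^ 2 = 4 ^ k) (i : Fin 4) :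
    ∃ m : ℤ, m ∈ Set.Icc (-2 : ℤ) 2 ∧ (v i : ℚ) / 2 ^ k = m / 2 := by
  induction k generalizing v with
  | zero =>
    have hle : v i ^ 2 ≤ 1 := by
      rw [pow_zero] at hv
      rw [← hv]
      exact Finset.single_le_sum (fun j _ => sq_nonneg (v j)) (Finset.mem_univ i)
    refine ⟨2 * v i, ?_, by push_cast; ring⟩
    constructor <;> nlinarith
  | succ k ih =>
    rcases Nat.eq_zero_or_pos k with rfl | hk
    · have hle : v i ^ 2 ≤ 4 := by
        rw [← show (4 : ℤ) ^ (0 + 1) = 4 by norm_num, ← hv]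
        exact Finset.single_le_sum (fun j _ => sq_nonneg (v j)) (Finset.mem_univ i)
      refine ⟨v i, ?_, by push_cast; ring⟩
      constructor <;> nlinarith
    · -- `k + 1 ≥ 2`: all entries are even, divide by two and recurse
      have h8 : (8 : ℤ) ∣ 4 ^ (k + 1) := by
        obtain ⟨k', rfl⟩ := Nat.exists_eq_add_of_le hk
        exact ⟨2 * 4 ^ k', by ring⟩
      have hsum : ∑ j, v j ^ 2 = v 0 ^ 2 + v 1 ^ 2 + v 2 ^ 2 + v 3 ^ 2 := by
        simp [Fin.sum_univ_four]
      have heven : ∀ j, (2 : ℤ) ∣ v j := by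
        intro j
        rw [← hv, hsum] at h8
        fin_cases j
        · show (2 : ℤ) ∣ v 0
          exact two_dvd_of_eight_dvd_sum_sq h8
        · show (2 : ℤ) ∣ v 1
          exact two_dvd_of_eight_dvd_sum_sq (b := v 0) (c := v 2) (d := v 3) (by convert h8 using 1; ring)
        · show (2 : ℤ) ∣ v 2
          exact two_dvd_of_eight_dvd_sum_sq (b := v 0) (c := v 1) (d := v 3) (by convert h8 using 1; ring)
        · show (2 : ℤ) ∣ v 3
          exact two_dvd_of_eight_dvd_sum_sq (b := v 0) (c := v 1) (d := v 2) (by convert h8 using 1; ring)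
      choose v' hv' using heven
      have hv'sum : ∑ j, v' j ^ 2 = 4 ^ k := by
        have : ∑ j, v j ^ 2 = 4 * ∑ j, v' j ^ 2 := by
          rw [Finset.mul_sum]
          exact Finset.sum_congr rfl fun j _ => by rw [hv' j]; ring
        have h4 : (4 : ℤ) ^ (k + 1) = 4 * 4 ^ k := by ring
        rw [hv, h4] at this
        linarith
      obtain ⟨m, hm, hmeq⟩ := ih v' hv'sum
      refine ⟨m, hm, ?_⟩
      rw [← hmeq, hv' i]
      push_cast
      field_simp
      ring

/-- The finite set `{0, ±½, ±1}` containing every entry of every element of `Γ_4`. [folklore] -/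
def halfIntegers : Set ℚ := (fun m : ℤ => (m : ℚ) / 2) '' Set.Icc (-2 : ℤ) 2

/-- `{0, ±½, ±1}` is finite. [folklore] -/
theorem halfIntegers_finite : halfIntegers.Finite := (Set.finite_Icc _ _).image _

/-- Every entry of an element of `Γ_4 = O_4(ℤ[1/2])` lies in `{0, ±½, ±1}`. [folklore] -/
theorem entry_mem_halfIntegers (g : dyadicOrthogonalGroup 4) (i j : Fin 4) :
    ((g : Matrix.orthogonalGroup (Fin 4) ℚ) : Matrix (Fin 4) (Fin 4) ℚ) i j ∈ halfIntegers := by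
  set A : Matrix (Fin 4) (Fin 4) ℚ := ((g : Matrix.orthogonalGroup (Fin 4) ℚ) : Matrix (Fin 4) (Fin 4) ℚ)
  -- dyadic entries of column `j`, with a common denominator `2^K`
  have hdy : ∀ i, ∃ (a : ℤ) (k : ℕ), A i j = a / 2 ^ k := fun i => g.2 i j
  choose a k hak using hdy
  set K : ℕ := ∑ i, k i
  have hkK : ∀ i, k i ≤ K := fun i => Finset.single_le_sum (fun l _ => Nat.zero_le (k l)) (Finset.mem_univ i)
  obtain ⟨v, hvdef⟩ : ∃ v : Fin 4 → ℤ, ∀ i, v i = a i * 2 ^ (K - k i) := ⟨_, fun _ => rfl⟩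
  have hvA : ∀ i, A i j = (v i : ℚ) / 2 ^ K := by
    intro i
    rw [hak i, hvdef i]
    have : (2 : ℚ) ^ K = 2 ^ k i * 2 ^ (K - k i) := by rw [← pow_add, Nat.add_sub_cancel' (hkK i)]
    rw [this]
    push_cast
    field_simp
  -- column `j` has norm `1`
  have hcol : ∑ i, A i j * A i j = 1 := by
    have h1 : Aᵀ * A = 1 := (Matrix.mem_orthogonalGroup_iff' (Fin 4) ℚ).1 g.1.2
    have := congrFun (congrFun h1 j) j
    simpa [Matrix.mul_apply, Matrix.transpose_apply] using this
  have hv : ∑ i, v i ^ 2 = 4 ^ K := by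
    have hq : ∑ i, ((v i : ℚ) / 2 ^ K) ^ 2 = 1 := by
      simpa [hvA, pow_two] using hcol
    have h2K : (2 : ℚ) ^ K ≠ 0 := pow_ne_zero _ two_ne_zero
    have hq' : ∑ i, (v i : ℚ) ^ 2 = (2 ^ K) ^ 2 := by
      simp only [div_eq_mul_inv, mul_pow, inv_pow] at hq
      rw [← Finset.sum_mul, mul_inv_eq_one₀ (pow_ne_zero _ h2K)] at hq
      exact hq
    have h4 : ((2 : ℚ) ^ K) ^ 2 = ((4 : ℤ) ^ K : ℚ) := by
      push_cast; rw [← pow_mul, mul_comm, pow_mul]; norm_num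
    exact_mod_cast (hq'.trans h4)
  obtain ⟨m, hm, hmeq⟩ := half_integer_of_sum_sq_eq K v hv i
  exact ⟨m, hm, show (m : ℚ) / 2 = A i j by rw [hvA i, hmeq]⟩

/-- **`Γ_4 = O_4(ℤ[1/2])` is finite** (two rebits with `{X, CX, H ⊗ H}` generate a finite group):
all entries lie in `{0, ±½, ±1}`. [folklore] -/
theorem finite_dyadicOrthogonalGroup_four : Finite (dyadicOrthogonalGroup 4) := by
  let f : dyadicOrthogonalGroup 4 → Matrix (Fin 4) (Fin 4) ℚ := fun g =>
    ((g : Matrix.orthogonalGroup (Fin 4) ℚ) : Matrix (Fin 4) (Fin 4) ℚ)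
  have hinj : Function.Injective f := fun g h hgh => Subtype.ext (Subtype.ext hgh)
  let T : Set (Matrix (Fin 4) (Fin 4) ℚ) := Set.univ.pi fun _ => Set.univ.pi fun _ => halfIntegers
  have hT : T.Finite := Set.Finite.pi fun _ => Set.Finite.pi fun _ => halfIntegers_finite
  have hsub : Set.range f ⊆ T := by
    rintro _ ⟨g, rfl⟩
    exact fun i _ j _ => entry_mem_halfIntegers g i j
  haveI : Finite (Set.range f) := (hT.subset hsub).to_subtype
  exact Finite.of_injective (fun g => (⟨f g, Set.mem_range_self g⟩ : Set.range f))
    fun g h hgh => hinj (by simpa using congrArg Subtype.val hgh)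

/-! ### The `2`-adic rank input: `x₁² + ⋯ + x₈²` is hyperbolic over `ℚ₂` -/

open Polynomial in
/-- `-7` is a square in `ℤ₂` (Hensel's lemma for `X² + 7` at `a = 1`: `‖8‖ = 2⁻³ < ‖2‖² = 2⁻²`).
[folklore] -/
theorem exists_sq_eq_neg_seven : ∃ u : ℤ_[2], u ^ 2 = -7 := by
  let F : Polynomial ℤ := X ^ 2 + C 7
  have hF : ∀ z : ℤ_[2], F.aeval z = z ^ 2 + 7 := fun z => by
    rw [map_add, map_pow, aeval_X, aeval_C, map_ofNat]
  have hF' : ∀ z : ℤ_[2], (derivative F).aeval z = 2 * z := fun z => by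
    rw [derivative_add, derivative_X_pow, derivative_C, add_zero, map_mul, map_pow, aeval_X, aeval_C]
    norm_num
  have h2 : ‖(2 : ℤ_[2])‖ = 2⁻¹ := by
    have := PadicInt.norm_p (p := 2); exact_mod_cast this
  have h8 : ‖(8 : ℤ_[2])‖ = 2⁻¹ ^ 3 := by
    rw [show (8 : ℤ_[2]) = (2 : ℤ_[2]) ^ 3 by norm_num, norm_pow, h2]
  have hnorm : ‖F.aeval (1 : ℤ_[2])‖ < ‖(derivative F).aeval (1 : ℤ_[2])‖ ^ 2 := by
    rw [hF, hF']; norm_num; rw [h8, h2]; norm_num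
  obtain ⟨z, hz, -⟩ := hensels_lemma hnorm
  refine ⟨z, ?_⟩
  rw [hF] at hz
  linear_combination hz

/-- The left-multiplication matrix `L(a + bi + cj + dk)` of a quaternion; `Lᵀ L = (a²+b²+c²+d²)·1`.
[folklore] -/
def quatMat {R : Type*} [CommRing R] (a b c d : R) : Matrix (Fin 4) (Fin 4) R :=
  !![a, -b, -c, -d; b, a, -d, c; c, d, a, -b; d, -c, b, a]

/-- `L(q)ᵀ L(q) = N(q) · 1`. [folklore] -/
theorem quatMat_transpose_mul {R : Type*} [CommRing R] (a b c d : R) :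
    (quatMat a b c d)ᵀ * quatMat a b c d = (a ^ 2 + b ^ 2 + c ^ 2 + d ^ 2) • (1 : Matrix (Fin 4) (Fin 4) R) := by
  ext i j
  fin_cases i <;> fin_cases j <;>
    simp [quatMat, Matrix.mul_apply, Fin.sum_univ_four] <;> ring

/-- **`8·⟨1⟩` is hyperbolic over `ℚ₂` (certificate for `rank_{ℚ₂} SO₈ = 4 ≥ 2`).** There is
`T ∈ M₄(ℤ₂)` with `Tᵀ T = -1` (`T = L(u + i + j + 2k)`, `u² = -7`, so `N = -7 + 6 = -1`); by
`graph_totally_isotropic` the graph `{(v, Tv)}` is a totally isotropic rank-`4` direct summand of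
`(ℤ₂⁸, x₁² + ⋯ + x₈²)`. (Compare [cite: Omeara1963, 63:19]: spaces of dimension `≥ 5` over a
local field are isotropic.) [folklore] -/
theorem exists_antiIsometry_two_adic : ∃ T : Matrix (Fin 4) (Fin 4) ℤ_[2], Tᵀ * T = -1 := by
  obtain ⟨u, hu⟩ := exists_sq_eq_neg_seven
  refine ⟨quatMat u 1 1 2, ?_⟩
  rw [quatMat_transpose_mul, hu]
  norm_num

/-- If `Tᵀ T = -1` then `⟨(v, Tv), (v', Tv')⟩ = v·v' + Tv·Tv' = 0` for the sum-of-squares form: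
the graph of `T` is totally isotropic. [folklore] -/
theorem graph_totally_isotropic {R : Type*} [CommRing R] {m : ℕ} {T : Matrix (Fin m) (Fin m) R}
    (hT : Tᵀ * T = -1) (v v' : Fin m → R) : v ⬝ᵥ v' + (T *ᵥ v) ⬝ᵥ (T *ᵥ v') = 0 := by
  calc v ⬝ᵥ v' + (T *ᵥ v) ⬝ᵥ (T *ᵥ v')
      = v ⬝ᵥ v' + ((T *ᵥ v) ᵥ* T) ⬝ᵥ v' := by rw [dotProduct_mulVec]
    _ = v ⬝ᵥ v' + ((Tᵀ * T) *ᵥ v) ⬝ᵥ v' := by rw [← mulVec_transpose, mulVec_mulVec]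
    _ = 0 := by rw [hT]; simp [Matrix.neg_mulVec]

end LatticeRigidity

end Literature.Barriers.QuantumAdvantage

end
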